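import Summits.QuantumFields.YangMills.Theorems.BalabanUVNodesK0Stub1Letter165OfCriticalFlatOps
import Summits.QuantumFields.YangMills.Theorems.BalabanUVNodesK0FlatPortBodyP
import Summits.QuantumFields.YangMills.Theorems.UnitScaleTiltProp8HalvingQuarterMatrix
import HarnessLib

/-!
# K0⁷ STUB 1 (`stub_prop8StepCoP13`), sub-target S4a — **THE (165) ENTRY FOR THE TANGENT COMPONENT WITH THE PORT's `G̃`-LETTER DISCHARGED**: p596821's
# `letter165_tangent_of_critical128_recordDom_lieSU` ((128)-critical + (152)-small ⇒ every letter `N` of `−G̃_V` bounds `A₁ = A′ − H_V(Q_VA′)` by `B·C₄ρ²`, the letter a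
# HYPOTHESIS `hN`) COMPOSED with k0-s1-w3's d = 4 port (P9 `K0FlatPortBodyP.body_of_adm22_T4`: the canonical flat `H`, `G̃` of every admissible nested family on `Site (F.P K) 0`
# WITH their [B6] letters) through the matrix-current edition of the `G̃` sup∕gradient letter (UST `HalvingGtMatrix.matrixGtSup`, here ported to generic carrier and `M_N(ℂ)`):
# the sup, gradient and Laplacian rows of [15] (165) for `A₁` hold with the PORT's constant `B₀` — trigger (t2) of this seat's HANDOFF § g0∕g2 («port letters ⇒ `hN`∕`hG` become theorems»)

Cell `pub-ymgap`, width seat `pub-ymgap-k0-s1-w1` g3 (INTENT-2).  `--kind proof --supports stmt-QuantumFields-20541 --as helper`; count-neutral.  [15] = [Balaban1985Variational];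
[B6] = [Balaban1984PropagatorsII].

WHY.  Print p. 303–304: *«A = A₁ + HB − HD(A₁ + HB), (159) where A₁ satisfies Eq. (158) … the equality (159) and Eq. (158) imply |A|, |∇^ηA|, … < ¼M_Δmax{B₃ε₁, ½ε₀} +
B₀C₄(36dL²B₁Mε₀)² + …  (165)»*; the middle term is `|A₁| ≤ B₀|W(A₁ + HB)|₍₋₃₎ ≤ B₀C₄ρ²` by `A₁ = −G̃W(A₁ + HB)` and the letter `|G̃f| ≤ B₀|f|₍₋₃₎` of [B6] Prop. 2.2.  In the tree:
p596821 proved the (165) ENTRY for `A₁` against an ARBITRARY letter `N` of `−G̃_V` (hypothesis `hN`); k0-s1-w3 g2's S5 ROAD ported lit-balaban's [B6] rows to d = 4 and packaged, for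
every `Adm22` family on the record's tori, the canonical operators WITH the scalar letter `GtSupLetterG` (P9, (a) `K0FlatCubeOpsTextP.BodyAt`); the route UnitScaleTilt showed (d = 3,
`M_2(ℂ)`) that the scalar letter transfers to matrix-valued currents WITHOUT component loss (`HalvingGtMatrix.matrixGtSup`: norm-dominated readings commute with kernel extensions +
`‖M‖ = sup_g g(M)`).  THIS FILE ports that transfer to `(P, k)`, `M_N(ℂ)` and composes the three.

WHAT IS PROVED (sorry-free; no definition; axioms standard).
* §1 `reFunctional_kernel` — `g(𝒯B(k)) = T(g ∘ B)(k)` for kernel extensions to `M_N(ℂ)`-valued data (UST's `reFunctional_kernel'` at `Fin N`).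
* §2 ★ `matrixGtSupP` — k0-s1-w3's `GtSupLetterG P k w G̃ B₀` (scalar) ⇒ for the kernel extension `𝒢f(b) = Σ_{b′}(G̃e_{b′})(b)·f(b′)` of a matrix current with `w₃‖f‖ ≤ β`:
  `w₁(b)‖𝒢f(b)‖ ≤ B₀β` and `w₂(b)L^k‖𝒢f(b + e_ν) − 𝒢f(b)‖ ≤ B₀β` (every `P`, `k`, `N`, direction `ν : Fin P.d`); ★ `matrixGtLaplaceP` — the same transfer for the Laplacian
  letter `GtLaplaceLetterG` (`w₃(b)L^{2k}‖Σ_ν((𝒢f(b) − 𝒢f(b+e_ν)) + (𝒢f(b) − 𝒢f(b−e_ν)))‖ ≤ B₀β`).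
* §3 ★★ `letter165_rows_of_critical128_bodyAt` — on `Site (F.P K) 0`, for a nested family `D` with `BodyAt (F.P K) k D w B₀ δ₀ B₃` and nonnegative weights: p596821's
  hypotheses MINUS `hN` (extensions `Δ_V, G̃_V, Q_V, H_V` at `c = L^k`, `a ≡ 1`; Prop. 4's slot `hWq`; `X : bonds → 𝔰𝔲(N)` with `W(X)` skew∕traceless; (128); sizes `≤ ρ < a₃`) ⇒
  `w₁(b)‖A₁(b)‖ ≤ B₀C₄ρ²` and `w₂(b)L^k‖A₁(b + e_ν) − A₁(b)‖ ≤ B₀C₄ρ²`; ★★★ `exists_letter165_rows_of_adm22_T4` — the same for EVERY admissible family of the record's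
  tori with P9's thresholds `Mh₀`, `R₀` and ONE constant `B₀` (the (152) level weights `IsLevWeight`, top level `K − n`, `1 ≤ K − n`, `K − n + 1 ≤ m + K`).
TECHNICAL NOTE.  p595460∕p596821 elaborated `Pi.single j 1` with the classical `DecidableEq` on bonds; k0-s1-w3's port chain imports the constructive
`B6Prop26ReachTransplant.instDecidableEqPBond`.  §3 therefore goes through p596821 v1.2's instance-generic edition `…_recordDom_lieSU_inst` and itself takes the two instances
as unifiable implicit arguments; §2 takes the instance as an argument.
HONEST SCOPE.  A COMPOSITION of tree theorems (p596821 ∘ k0-s1-w3 P9 ∘ UST's transfer device); still DISPLAYED: Prop. 4's weighted (98)-slot `hWq` (S4b: k0-s1-w2's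
`exists_sectF_W_levOf` supplies a `W` of this shape modulo its own port letters), (128) at a critical configuration (S2's chart; which tangent-space reading it carries at the
record is S2's decision — this seat's `…FlatAveragingDictionary` gives the gauge-equivalence of the two candidates at the linear flat level), the (115)∕(152) sizes (S3), and the `∂*∂` row of (165) (not a letter of `G̃`; print routes it through (87)∕(137)).  FLAT background; nothing of Bałaban's
analysis asserted beyond the cited kernel theorems; `stub_prop8StepCoP13` ∕ K0⁷ NOT closed; N07 NOT discharged; counts unmoved (28∕28 · 5∕27); one finite 𝕋⁴ programme at fixed
ε — R4 closes the conditional finite-𝕋⁴ rung `BalabanLadder.UV` only, never the summit; the YM mass gap (Clay) is NOT proved by any of this; nothing continuum ∕ ℝ⁴ ∕ OS.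
No `sorry`, no `def`, no `instance`, no `notation`.

References: [15] (46) p.285, (115) p.294, (128) p.297, (152) p.301, (158)–(159) pp.302–303, (165) p.304; [B6] (2.1)–(2.2) p.224, Prop. 2.2 (2.47) p.231, (2.48)–(2.51)
p.232, Cor. 2.8 (2.150)–(2.151) p.249.
-/

set_option autoImplicit false
noncomputable section
open scoped BigOperators Matrix Matrix.Norms.L2Operator

namespace Summit.QuantumFields.YangMills.Theorems.K0Stub1Letter165GtLetterAtRecord

open Literature.MathematicalPhysics.QuantumFieldTheory.Balaban1983to89
open Literature.MathematicalPhysics.QuantumFieldTheory.Balaban1983to89.T4Continuum (T4Family)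
open B6SectADomainsV1 (Domains)
open B6SectAOperatorsV1 (BondIdx BondIdxSpace QE QsE)
open B6SectAVectorModelV1 (deltaAE GE EE)
open B6SectA (hOp)
open T4AdjointCovarianceUnitary (lieSU mem_lieSU_iff)
open Summit.QuantumFields.YangMills.Theorems.K0FlatCubeOpsTextP (IsFlatGt GtSupLetterG GtLaplaceLetterG BodyAt IsLevWeight levWeight_nonneg)
open Summit.QuantumFields.YangMills.Theorems.HalvingQuarterMatrix (norm_le_of_forall_reFunctional)
open Summit.QuantumFields.YangMills.Theorems.K0Stub1Letter165OfCriticalFlatOps (letter165_tangent_of_critical128_recordDom_lieSU_inst)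
open Summit.QuantumFields.YangMills.Theorems.K0FlatPortBodyP (body_of_adm22_T4)
open Summit.QuantumFields.YangMills.Theorems.FlatCubeOpsText (Adm22)

variable {N : ℕ}

/-! ## §1  Norm-dominated real readings commute with kernel extensions (UST `HalvingGtMatrix.reFunctional_kernel'`, index- AND size-generic) -/

section Kernel

variable {ι κ : Type*} [Fintype ι] [DecidableEq ι]

/-- **`g(𝒯B(k)) = T(g ∘ B)(k)`** for the kernel extension `𝒯B(k) = Σ_i (Te_i)(k)·B(i)` of a real linear `T` to `M_N(ℂ)`-valued data and every reading `g(M) = r·Re(u·f(M))`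
(UST `HalvingGtMatrix.reFunctional_kernel'`, written there for `M_2(ℂ)`; verbatim at `M_N(ℂ)`). [cite: Balaban1985Variational, (158) p.302] -/
theorem reFunctional_kernel (T : (ι → ℝ) →ₗ[ℝ] (κ → ℝ)) {B : ι → Matrix (Fin N) (Fin N) ℂ} {𝔄 : κ → Matrix (Fin N) (Fin N) ℂ}
    (h𝔄 : ∀ k, 𝔄 k = ∑ i, T (Pi.single i 1) k • B i) (f : StrongDual ℂ (Matrix (Fin N) (Fin N) ℂ)) (u : ℂ) (r : ℝ) (k : κ) :
    r * (u * f (𝔄 k)).re = T (fun i => r * (u * f (B i)).re) k := by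
  have hX : (fun i => r * (u * f (B i)).re) = ∑ i, (r * (u * f (B i)).re) • (Pi.single i (1 : ℝ) : ι → ℝ) := by
    funext i'
    rw [Finset.sum_apply, Finset.sum_eq_single i' (fun i _ hi => by simp [Ne.symm hi]) (fun h => absurd (Finset.mem_univ _) h)]
    simp
  have hR : T (fun i => r * (u * f (B i)).re) k = ∑ i, (r * (u * f (B i)).re) * T (Pi.single i 1) k := by
    rw [hX, map_sum, Finset.sum_apply]
    refine Finset.sum_congr rfl fun i _ => ?_
    rw [LinearMap.map_smul, Pi.smul_apply, smul_eq_mul]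
  have hL : f (𝔄 k) = ∑ i, ((T (Pi.single i 1) k : ℝ) : ℂ) * f (B i) := by
    rw [h𝔄 k, map_sum]
    refine Finset.sum_congr rfl fun i _ => ?_
    rw [ContinuousLinearMap.map_smul_of_tower, Complex.real_smul]
  rw [hR, hL, Finset.mul_sum, Complex.re_sum, Finset.mul_sum]
  refine Finset.sum_congr rfl fun i _ => ?_
  rw [mul_left_comm u, Complex.re_ofReal_mul]
  ring

end Kernel

/-! ## §2  THE `G̃` SUP∕GRADIENT LETTER FOR MATRIX-VALUED CURRENTS, generic carrier (the d-generic ∕ N-generic port of UST `HalvingGtMatrix.matrixGtSup` over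
k0-s1-w3's `K0FlatCubeOpsTextP.GtSupLetterG`) -/

section Gt

variable {P : Params} {k : ℕ}

/-- ★ **THE WEIGHTED SUP AND GRADIENT LETTERS OF `G̃` FOR A MATRIX-VALUED CURRENT, WITHOUT COMPONENT LOSS** (k0-s1-w3's `GtSupLetterG P k w Gt B₀` with `|·| ↦ ‖·‖`):
nonnegative weights, `0 ≤ β`, `w₃(b)‖f(b)‖ ≤ β` and the kernel extension `𝒢f(b) = Σ_{b′} (G̃e_{b′})(b)·f(b′)` give `w₁(b)‖𝒢f(b)‖ ≤ B₀β` and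
`w₂(b)Lᵏ‖𝒢f(⟨b₋ + e_ν, dir b⟩) − 𝒢f(b)‖ ≤ B₀β` — UST `HalvingGtMatrix.matrixGtSup` (d = 3, `M_2(ℂ)`, `T3Family`) re-run at `(P, k)`, `M_N(ℂ)`, every direction `ν : Fin P.d`
(device: every norm-dominated reading commutes with the kernel extension, §1, and `‖M‖ = sup_g g(M)`, UST `HalvingQuarterMatrix.norm_le_of_forall_reFunctional`).
[cite: Balaban1985Variational, (158) p.302, (165) p.304; Balaban1984PropagatorsII, Prop. 2.2 (2.47) p.231, (2.48)-(2.51) p.232] -/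
theorem matrixGtSupP [DecidableEq (PBond P 0)] {w : ℕ → PBond P 0 → ℝ} {Gt : (PBond P 0 → ℝ) →ₗ[ℝ] (PBond P 0 → ℝ)} {B₀ β : ℝ}
    (hGt : GtSupLetterG P k w Gt B₀) (hw0 : ∀ m b, 0 ≤ w m b) (hβ : 0 ≤ β)
    {f 𝒢 : PBond P 0 → Matrix (Fin N) (Fin N) ℂ} (h𝒢 : ∀ b, 𝒢 b = ∑ b', Gt (Pi.single b' 1) b • f b')
    (hf : ∀ b, w 3 b * ‖f b‖ ≤ β) :
    (∀ b, w 1 b * ‖𝒢 b‖ ≤ B₀ * β) ∧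
    ∀ (b : PBond P 0) (ν : Fin P.d), w 2 b * (P.L : ℝ) ^ k * ‖𝒢 ⟨b.src.shift ν, b.dir⟩ - 𝒢 b‖ ≤ B₀ * β := by
  have hLk : (0 : ℝ) < (P.L : ℝ) ^ k := pow_pos (Nat.cast_pos.mpr P.L_pos) k
  -- `0 ≤ B₀β` from the letter at the zero current
  have hB₀β : 0 ≤ B₀ * β := by
    obtain ⟨b⟩ : Nonempty (PBond P 0) := ⟨⟨fun _ => 0, ⟨0, P.hd⟩⟩⟩
    have h := (hGt 0 β hβ (fun b => by rw [Pi.zero_apply, abs_zero, mul_zero]; exact hβ)).1 b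
    rwa [map_zero, Pi.zero_apply, abs_zero, mul_zero] at h
  -- the real letter for every norm-dominated reading of the current
  have key : ∀ (fd : StrongDual ℂ (Matrix (Fin N) (Fin N) ℂ)) (u : ℂ) (r : ℝ),
      (∀ y : Matrix (Fin N) (Fin N) ℂ, |r * (u * fd y).re| ≤ ‖y‖) →
      (∀ b, w 1 b * |Gt (fun b' => r * (u * fd (f b')).re) b| ≤ B₀ * β) ∧
      ∀ (b : PBond P 0) (ν : Fin P.d),
        w 2 b * (P.L : ℝ) ^ k * |Gt (fun b' => r * (u * fd (f b')).re) ⟨b.src.shift ν, b.dir⟩ - Gt (fun b' => r * (u * fd (f b')).re) b| ≤ B₀ * β :=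
    fun fd u r hg => hGt _ β hβ fun b' => (mul_le_mul_of_nonneg_left (hg (f b')) (hw0 3 b')).trans (hf b')
  refine ⟨fun b => ?_, fun b ν => ?_⟩
  · rcases (hw0 1 b).lt_or_eq with hpos | hzero
    · rw [← le_div_iff₀' hpos]
      refine norm_le_of_forall_reFunctional (𝒢 b) (div_nonneg hB₀β hpos.le) fun fd u r hg => ?_
      rw [reFunctional_kernel Gt h𝒢 fd u r b, le_div_iff₀' hpos]
      exact (mul_le_mul_of_nonneg_left (le_abs_self _) hpos.le).trans ((key fd u r hg).1 b)
    · rw [← hzero, zero_mul]; exact hB₀β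
  · rcases (hw0 2 b).lt_or_eq with hpos | hzero
    · have hpos' : 0 < w 2 b * (P.L : ℝ) ^ k := mul_pos hpos hLk
      rw [← le_div_iff₀' hpos']
      refine norm_le_of_forall_reFunctional _ (div_nonneg hB₀β hpos'.le) fun fd u r hg => ?_
      have hlin : r * (u * fd (𝒢 ⟨b.src.shift ν, b.dir⟩ - 𝒢 b)).re =
          Gt (fun b' => r * (u * fd (f b')).re) ⟨b.src.shift ν, b.dir⟩ - Gt (fun b' => r * (u * fd (f b')).re) b := by
        rw [map_sub, mul_sub, Complex.sub_re, mul_sub, reFunctional_kernel Gt h𝒢 fd u r, reFunctional_kernel Gt h𝒢 fd u r]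
      rw [hlin, le_div_iff₀' hpos']
      exact (mul_le_mul_of_nonneg_left (le_abs_self _) hpos'.le).trans ((key fd u r hg).2 b ν)
    · rw [← hzero, zero_mul, zero_mul]; exact hB₀β

/-- ★ **THE LAPLACIAN LETTER OF `G̃` FOR A MATRIX-VALUED CURRENT** (k0-s1-w3's `GtLaplaceLetterG P k w G̃ B₀`, the `Δ` row of the second-order letters of (165), with
`|·| ↦ ‖·‖`): `w₃(b)·L^{2k}·‖Σ_ν ((𝒢f(b) − 𝒢f(b + e_ν)) + (𝒢f(b) − 𝒢f(b − e_ν)))‖ ≤ B₀β` — same device. [cite: Balaban1985Variational, (165) p.304; Balaban1984PropagatorsII, Prop. 2.6 (2.136) p.247] -/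
theorem matrixGtLaplaceP [DecidableEq (PBond P 0)] {w : ℕ → PBond P 0 → ℝ} {Gt : (PBond P 0 → ℝ) →ₗ[ℝ] (PBond P 0 → ℝ)} {B₀ β : ℝ}
    (hGt : GtLaplaceLetterG P k w Gt B₀) (hGt0 : GtSupLetterG P k w Gt B₀) (hw0 : ∀ m b, 0 ≤ w m b) (hβ : 0 ≤ β)
    {f 𝒢 : PBond P 0 → Matrix (Fin N) (Fin N) ℂ} (h𝒢 : ∀ b, 𝒢 b = ∑ b', Gt (Pi.single b' 1) b • f b')
    (hf : ∀ b, w 3 b * ‖f b‖ ≤ β) (b : PBond P 0) :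
    w 3 b * (((P.L : ℝ) ^ k) ^ 2) * ‖∑ ν : Fin P.d, ((𝒢 b - 𝒢 ⟨b.src.shift ν, b.dir⟩) + (𝒢 b - 𝒢 ⟨b.src.unshift ν, b.dir⟩))‖ ≤ B₀ * β := by
  have hLk : (0 : ℝ) < ((P.L : ℝ) ^ k) ^ 2 := pow_pos (pow_pos (Nat.cast_pos.mpr P.L_pos) k) 2
  -- `0 ≤ B₀β` from the sup letter at the zero current
  have hB₀β : 0 ≤ B₀ * β := by
    obtain ⟨b₀⟩ : Nonempty (PBond P 0) := ⟨⟨fun _ => 0, ⟨0, P.hd⟩⟩⟩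
    have h := (hGt0 0 β hβ (fun b => by rw [Pi.zero_apply, abs_zero, mul_zero]; exact hβ)).1 b₀
    rwa [map_zero, Pi.zero_apply, abs_zero, mul_zero] at h
  have key : ∀ (fd : StrongDual ℂ (Matrix (Fin N) (Fin N) ℂ)) (u : ℂ) (r : ℝ),
      (∀ y : Matrix (Fin N) (Fin N) ℂ, |r * (u * fd y).re| ≤ ‖y‖) →
      w 3 b * (((P.L : ℝ) ^ k) ^ 2) * |∑ ν : Fin P.d, ((Gt (fun b' => r * (u * fd (f b')).re) b - Gt (fun b' => r * (u * fd (f b')).re) ⟨b.src.shift ν, b.dir⟩) +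
        (Gt (fun b' => r * (u * fd (f b')).re) b - Gt (fun b' => r * (u * fd (f b')).re) ⟨b.src.unshift ν, b.dir⟩))| ≤ B₀ * β :=
    fun fd u r hg => hGt _ β hβ (fun b' => (mul_le_mul_of_nonneg_left (hg (f b')) (hw0 3 b')).trans (hf b')) b
  rcases (hw0 3 b).lt_or_eq with hpos | hzero
  · have hpos' : 0 < w 3 b * (((P.L : ℝ) ^ k) ^ 2) := mul_pos hpos hLk
    rw [← le_div_iff₀' hpos']
    refine norm_le_of_forall_reFunctional _ (div_nonneg hB₀β hpos'.le) fun fd u r hg => ?_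
    have hlin : r * (u * fd (∑ ν : Fin P.d, ((𝒢 b - 𝒢 ⟨b.src.shift ν, b.dir⟩) + (𝒢 b - 𝒢 ⟨b.src.unshift ν, b.dir⟩)))).re =
        ∑ ν : Fin P.d, ((Gt (fun b' => r * (u * fd (f b')).re) b - Gt (fun b' => r * (u * fd (f b')).re) ⟨b.src.shift ν, b.dir⟩) +
          (Gt (fun b' => r * (u * fd (f b')).re) b - Gt (fun b' => r * (u * fd (f b')).re) ⟨b.src.unshift ν, b.dir⟩)) := by
      rw [map_sum, Finset.mul_sum, Complex.re_sum, Finset.mul_sum]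
      refine Finset.sum_congr rfl fun ν _ => ?_
      rw [map_add, map_sub, map_sub, mul_add, mul_sub, mul_sub, Complex.add_re, Complex.sub_re, Complex.sub_re, mul_add, mul_sub, mul_sub,
        reFunctional_kernel Gt h𝒢 fd u r, reFunctional_kernel Gt h𝒢 fd u r, reFunctional_kernel Gt h𝒢 fd u r]
    rw [hlin, le_div_iff₀' hpos']
    exact (mul_le_mul_of_nonneg_left (le_abs_self _) hpos'.le).trans (key fd u r hg)
  · rw [← hzero, zero_mul, zero_mul]; exact hB₀β

end Gt

/-! ## §3  THE (165) ENTRY FOR THE TANGENT COMPONENT WITH THE PORT's `G̃` LETTER DISCHARGED (p596821 ∘ §2 ∘ k0-s1-w3's `BodyAt` ∕ P9 `body_of_adm22_T4`) -/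

section Entry165

/-- ★★ **(128)-CRITICAL + (152)-SMALL ⇒ THE (165) SUP AND GRADIENT ROWS FOR `A₁ = A′ − H_V(Q_VA′)`, THE `G̃`-LETTER NO LONGER A HYPOTHESIS.**  On NODE 00's fine torus
`Site (F.P K) 0`, for a nested family `D` carrying k0-s1-w3's P2-body `BodyAt (F.P K) k D w B₀ δ₀ B₃` (the canonical `H = GQ*(QGQ*)⁻¹`, `G̃ = G − HQG` at lattice factor
`L^k`, auxiliary weights `a ≡ 1`, WITH their (46)∕`hG`∕(165)-Laplacian letters and the (161)–(163) rows — supplied for every `Adm22` family by P9 `body_of_adm22_T4`) and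
nonnegative level weights `w`: the componentwise extensions `Δ_V, G̃_V, Q_V, H_V` (p595460's kernel formulas at `c = L^k`, `a ≡ 1`), Prop. 4's weighted (98)-slot `hWq`
for `W` (S4b), a Lie-algebra field `X` with `W(X)` skew and traceless, (128) against all 𝔰𝔲(N)-valued tests in `ker Q_V` (S2), and the (115)∕(152)-size `≤ ρ < a₃` of `X` give
`w₁(b)·‖A₁(b)‖ ≤ B₀·C₄·ρ²`, `w₂(b)·L^k·‖A₁(b + e_ν) − A₁(b)‖ ≤ B₀·C₄·ρ²` and the Laplacian row `w₃(b)·L^{2k}·‖Σ_ν((A₁(b) − A₁(b+e_ν)) + (A₁(b) − A₁(b−e_ν)))‖ ≤ B₀·C₄·ρ²`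
at every fine bond and direction — p596821's `letter165_tangent_of_critical128_recordDom_lieSU` with its letter hypothesis `hN` DISCHARGED by §2 on the `GtSupLetterG` ∕
`GtLaplaceLetterG` clauses of `BodyAt`.
[cite: Balaban1985Variational, (152) p.301, (158) p.302, (165) p.304; Balaban1984PropagatorsII, Prop. 2.2 (2.47) p.231] -/
theorem letter165_rows_of_critical128_bodyAt (F : T4Family) (K k : ℕ) (D : Domains (F.P K))
    {w : ℕ → PBond (F.P K) 0 → ℝ} (hw0 : ∀ m b, 0 ≤ w m b) {B₀ δ₀ B₃ : ℝ} (hBody : BodyAt (F.P K) k D w B₀ δ₀ B₃)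
    {instDE : DecidableEq (PBond (F.P K) 0)} {instDB : DecidableEq (BondIdx D)}
    {DV GV : (PBond (F.P K) 0 → Matrix (Fin N) (Fin N) ℂ) →ₗ[ℂ] (PBond (F.P K) 0 → Matrix (Fin N) (Fin N) ℂ)}
    {QV : (PBond (F.P K) 0 → Matrix (Fin N) (Fin N) ℂ) →ₗ[ℂ] (BondIdx D → Matrix (Fin N) (Fin N) ℂ)}
    {HV : (BondIdx D → Matrix (Fin N) (Fin N) ℂ) →ₗ[ℂ] (PBond (F.P K) 0 → Matrix (Fin N) (Fin N) ℂ)}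
    (hDV : ∀ (A : PBond (F.P K) 0 → Matrix (Fin N) (Fin N) ℂ) (b : PBond (F.P K) 0),
      DV A b = ∑ j, ((WithLp.ofLp (deltaAE D ((F.P K).L ^ k : ℝ) (fun _ => (1 : ℝ)) (WithLp.toLp 2 (Pi.single j 1))) b : ℝ) : ℂ) • A j)
    (hGV : ∀ (A : PBond (F.P K) 0 → Matrix (Fin N) (Fin N) ℂ) (b : PBond (F.P K) 0),
      GV A b = ∑ j, ((WithLp.ofLp ((GE D (c := ((F.P K).L : ℝ) ^ k) (pow_ne_zero _ (Nat.cast_ne_zero.2 (F.P K).L_pos.ne')) (w := fun _ => (1 : ℝ)) (fun _ => one_pos)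
        - hOp (GE D (c := ((F.P K).L : ℝ) ^ k) (pow_ne_zero _ (Nat.cast_ne_zero.2 (F.P K).L_pos.ne')) (w := fun _ => (1 : ℝ)) (fun _ => one_pos)) (QsE D)
            (EE D (c := ((F.P K).L : ℝ) ^ k) (pow_ne_zero _ (Nat.cast_ne_zero.2 (F.P K).L_pos.ne')) (w := fun _ => (1 : ℝ)) (fun _ => one_pos))
          ∘ₗ QE D ∘ₗ GE D (c := ((F.P K).L : ℝ) ^ k) (pow_ne_zero _ (Nat.cast_ne_zero.2 (F.P K).L_pos.ne')) (w := fun _ => (1 : ℝ)) (fun _ => one_pos))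
        (WithLp.toLp 2 (Pi.single j 1))) b : ℝ) : ℂ) • A j)
    (hQV : ∀ (A : PBond (F.P K) 0 → Matrix (Fin N) (Fin N) ℂ) (t : BondIdx D),
      QV A t = ∑ j, ((WithLp.ofLp (QE D (WithLp.toLp 2 (Pi.single j 1))) t : ℝ) : ℂ) • A j)
    (hHV : ∀ (B : BondIdx D → Matrix (Fin N) (Fin N) ℂ) (b : PBond (F.P K) 0),
      HV B b = ∑ t, ((WithLp.ofLp (hOp (GE D (c := ((F.P K).L : ℝ) ^ k) (pow_ne_zero _ (Nat.cast_ne_zero.2 (F.P K).L_pos.ne')) (w := fun _ => (1 : ℝ)) (fun _ => one_pos))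
        (QsE D) (EE D (c := ((F.P K).L : ℝ) ^ k) (pow_ne_zero _ (Nat.cast_ne_zero.2 (F.P K).L_pos.ne')) (w := fun _ => (1 : ℝ)) (fun _ => one_pos))
        (WithLp.toLp 2 (Pi.single t 1))) b : ℝ) : ℂ) • B t)
    (W : (PBond (F.P K) 0 → Matrix (Fin N) (Fin N) ℂ) → (PBond (F.P K) 0 → Matrix (Fin N) (Fin N) ℂ)) {C₄ a₃ ρ : ℝ}
    (hWq : ∀ (Y : PBond (F.P K) 0 → Matrix (Fin N) (Fin N) ℂ) (r : ℝ), r < a₃ → (∀ b, w 1 b * ‖Y b‖ ≤ r) →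
      (∀ (b : PBond (F.P K) 0) (ν : Fin 4), w 2 b * (F.L : ℝ) ^ k * ‖Y ⟨b.src.shift ν, b.dir⟩ - Y b‖ ≤ r) →
        ∀ b, w 3 b * ‖W Y b‖ ≤ C₄ * r ^ 2)
    (X : PBond (F.P K) 0 → lieSU (Fin N))
    (hWA : ∀ j, (W (fun b => ((X b : lieSU (Fin N)) : Matrix (Fin N) (Fin N) ℂ)) j)ᴴ = -(W (fun b => ((X b : lieSU (Fin N)) : Matrix (Fin N) (Fin N) ℂ)) j))
    (hWtr : ∀ j, (W (fun b => ((X b : lieSU (Fin N)) : Matrix (Fin N) (Fin N) ℂ)) j).trace = 0)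
    (h128 : ∀ δ : PBond (F.P K) 0 → lieSU (Fin N), QV (fun j => ((δ j : lieSU (Fin N)) : Matrix (Fin N) (Fin N) ℂ)) = 0 →
      ∑ j, (((δ j : lieSU (Fin N)) : Matrix (Fin N) (Fin N) ℂ)ᴴ *
        (DV (fun b => ((X b : lieSU (Fin N)) : Matrix (Fin N) (Fin N) ℂ)) j + W (fun b => ((X b : lieSU (Fin N)) : Matrix (Fin N) (Fin N) ℂ)) j)).trace.re = 0)
    (hρ : ρ < a₃) (h1 : ∀ b, w 1 b * ‖((X b : lieSU (Fin N)) : Matrix (Fin N) (Fin N) ℂ)‖ ≤ ρ)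
    (h2 : ∀ (b : PBond (F.P K) 0) (ν : Fin 4),
      w 2 b * (F.L : ℝ) ^ k * ‖((X ⟨b.src.shift ν, b.dir⟩ : lieSU (Fin N)) : Matrix (Fin N) (Fin N) ℂ) - ((X b : lieSU (Fin N)) : Matrix (Fin N) (Fin N) ℂ)‖ ≤ ρ) :
    (∀ b : PBond (F.P K) 0,
      w 1 b * ‖((fun b => ((X b : lieSU (Fin N)) : Matrix (Fin N) (Fin N) ℂ)) - HV (QV fun b => ((X b : lieSU (Fin N)) : Matrix (Fin N) (Fin N) ℂ))) b‖
        ≤ B₀ * (C₄ * ρ ^ 2)) ∧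
    (∀ (b : PBond (F.P K) 0) (ν : Fin 4),
      w 2 b * (F.L : ℝ) ^ k *
        ‖((fun b => ((X b : lieSU (Fin N)) : Matrix (Fin N) (Fin N) ℂ)) - HV (QV fun b => ((X b : lieSU (Fin N)) : Matrix (Fin N) (Fin N) ℂ))) ⟨b.src.shift ν, b.dir⟩ -
          ((fun b => ((X b : lieSU (Fin N)) : Matrix (Fin N) (Fin N) ℂ)) - HV (QV fun b => ((X b : lieSU (Fin N)) : Matrix (Fin N) (Fin N) ℂ))) b‖
        ≤ B₀ * (C₄ * ρ ^ 2)) ∧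
    ∀ b : PBond (F.P K) 0,
      w 3 b * ((F.L : ℝ) ^ k) ^ 2 *
        ‖∑ ν : Fin 4, ((((fun b => ((X b : lieSU (Fin N)) : Matrix (Fin N) (Fin N) ℂ)) - HV (QV fun b => ((X b : lieSU (Fin N)) : Matrix (Fin N) (Fin N) ℂ))) b - ((fun b => ((X b : lieSU (Fin N)) : Matrix (Fin N) (Fin N) ℂ)) - HV (QV fun b => ((X b : lieSU (Fin N)) : Matrix (Fin N) (Fin N) ℂ))) ⟨b.src.shift ν, b.dir⟩) +
          (((fun b => ((X b : lieSU (Fin N)) : Matrix (Fin N) (Fin N) ℂ)) - HV (QV fun b => ((X b : lieSU (Fin N)) : Matrix (Fin N) (Fin N) ℂ))) b - ((fun b => ((X b : lieSU (Fin N)) : Matrix (Fin N) (Fin N) ℂ)) - HV (QV fun b => ((X b : lieSU (Fin N)) : Matrix (Fin N) (Fin N) ℂ))) ⟨b.src.unshift ν, b.dir⟩))‖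
        ≤ B₀ * (C₄ * ρ ^ 2) := by
  obtain ⟨H, Gt, -, hGt, -, hGtsup, hGtlap, -⟩ := hBody
  have hc : (((F.P K).L : ℝ)) ^ k ≠ 0 := pow_ne_zero _ (Nat.cast_ne_zero.2 (F.P K).L_pos.ne')
  -- the kernel of `G̃_V` IS the plain-function `G̃` pinned by `IsFlatGt`
  have h𝒢 : ∀ (f : PBond (F.P K) 0 → Matrix (Fin N) (Fin N) ℂ) (b : PBond (F.P K) 0), GV f b = ∑ b', Gt (Pi.single b' 1) b • f b' := by
    intro f b
    rw [hGV]
    refine Finset.sum_congr rfl fun j _ => ?_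
    rw [Complex.coe_smul, hGt (Pi.single j 1) b]
  -- `0 ≤ β` is forced by the weighted hypothesis at any bond
  have hβ_of : ∀ (f : PBond (F.P K) 0 → Matrix (Fin N) (Fin N) ℂ) (β : ℝ), (∀ b, w 3 b * ‖f b‖ ≤ β) → 0 ≤ β := fun f β hf =>
    (mul_nonneg (hw0 3 _) (norm_nonneg _)).trans (hf ⟨fun _ => 0, ⟨0, (F.P K).hd⟩⟩)
  -- p596821 for an arbitrary letter `Nl` bounded through `G̃_V` 
  have main : ∀ (Nl : (PBond (F.P K) 0 → Matrix (Fin N) (Fin N) ℂ) → ℝ),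
      (∀ (f : PBond (F.P K) 0 → Matrix (Fin N) (Fin N) ℂ) (β : ℝ), (∀ b, w 3 b * ‖f b‖ ≤ β) → Nl (-(GV f)) ≤ B₀ * β) →
      Nl ((fun b => ((X b : lieSU (Fin N)) : Matrix (Fin N) (Fin N) ℂ)) - HV (QV fun b => ((X b : lieSU (Fin N)) : Matrix (Fin N) (Fin N) ℂ))) ≤ B₀ * (C₄ * ρ ^ 2) :=
    fun Nl hN => letter165_tangent_of_critical128_recordDom_lieSU_inst F K k w D hc (fun _ => one_pos) (DV := DV) (GV := GV) (QV := QV) (HV := HV)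
      hDV hGV hQV hHV W hWq X hWA hWtr h128 hρ h1 h2 Nl hN
  refine ⟨fun b => main (fun g => w 1 b * ‖g b‖) fun f β hf => ?_, fun b ν => main (fun g => w 2 b * (F.L : ℝ) ^ k * ‖g ⟨b.src.shift ν, b.dir⟩ - g b‖) fun f β hf => ?_,
    fun b => main (fun g => w 3 b * ((F.L : ℝ) ^ k) ^ 2 * ‖∑ ν : Fin 4, ((g b - g ⟨b.src.shift ν, b.dir⟩) + (g b - g ⟨b.src.unshift ν, b.dir⟩))‖) fun f β hf => ?_⟩
  · rw [Pi.neg_apply, norm_neg]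
    exact (matrixGtSupP (N := N) hGtsup hw0 (hβ_of f β hf) (fun b' => h𝒢 f b') hf).1 b
  · rw [Pi.neg_apply, Pi.neg_apply, neg_sub_neg, norm_sub_rev]
    exact (matrixGtSupP (N := N) hGtsup hw0 (hβ_of f β hf) (fun b' => h𝒢 f b') hf).2 b ν
  · have hre : ∑ ν : Fin 4, (((-(GV f)) b - (-(GV f)) ⟨b.src.shift ν, b.dir⟩) + ((-(GV f)) b - (-(GV f)) ⟨b.src.unshift ν, b.dir⟩)) =
        -∑ ν : Fin 4, (((GV f) b - (GV f) ⟨b.src.shift ν, b.dir⟩) + ((GV f) b - (GV f) ⟨b.src.unshift ν, b.dir⟩)) := by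
      rw [← Finset.sum_neg_distrib]
      refine Finset.sum_congr rfl fun ν _ => ?_
      simp only [Pi.neg_apply]
      abel
    rw [hre, norm_neg]
    exact matrixGtLaplaceP (N := N) hGtlap hGtsup hw0 (hβ_of f β hf) (fun b' => h𝒢 f b') hf b


/-- ★★★ **AT EVERY ADMISSIBLE FAMILY ON THE RECORD's TORI, WITH THE PORT's CONSTANT.**  k0-s1-w3's P9 `body_of_adm22_T4` supplies collar thresholds `Mh₀`, `R₀` and ONE
constant `B₀` (lit-balaban's [B6] Cor. 2.8 rows ported to d = 4) such that: for all heights in the standing range (`1 ≤ K − n`, `K − n + 1 ≤ m + K`), every nested family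
`D` of top level `K − n` admissible in the sense [B6] (2.1)–(2.2) (`Adm22 D R (L·M_h)`, `M_h = L^{a′} ≥ Mh₀`, `R ≥ R₀`, `a′ + 3 ≤ m + n`), the (152) level weights `w`, the
componentwise extensions of print's flat operators of `D`, any `W` with Prop. 4's weighted (98)-slot, and every Lie-algebra field `X` that is (128)-critical and (152)-small:
**the (165) sup, gradient and Laplacian rows of the tangent component `A₁ = X − H_V(Q_VX)` hold with constant `B₀·C₄·ρ²`** — the `G̃`-letter of p596821 is a THEOREM here; displayed
remain Prop. 4's slot (S4b), (128) (S2), the sizes (S3). [cite: Balaban1985Variational, (152) p.301, (158) p.302, (165) p.304; Balaban1984PropagatorsII, (2.1)-(2.2) p.224, Cor. 2.8 (2.150)-(2.151) p.249] -/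
theorem exists_letter165_rows_of_adm22_T4 (F : T4Family) :
    ∃ (Mh₀ R₀ : ℕ) (B₀ : ℝ), ∀ (n K : ℕ) (_ : 1 ≤ K - n) (_ : K - n + 1 ≤ F.m + K) {Mh R a' : ℕ} (_ : Mh = F.L ^ a') (_ : Mh₀ ≤ Mh) (_ : R₀ ≤ R)
      (_ : a' + 3 ≤ F.m + n) (D : Domains (F.P K)) (_ : D.k = K - n) (_ : Adm22 D R (F.L * Mh))
      (w : ℕ → PBond (F.P K) 0 → ℝ) (_ : IsLevWeight (F.P K) (K - n) D w)
      {instDE : DecidableEq (PBond (F.P K) 0)} {instDB : DecidableEq (BondIdx D)}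
      {DV GV : (PBond (F.P K) 0 → Matrix (Fin N) (Fin N) ℂ) →ₗ[ℂ] (PBond (F.P K) 0 → Matrix (Fin N) (Fin N) ℂ)}
      {QV : (PBond (F.P K) 0 → Matrix (Fin N) (Fin N) ℂ) →ₗ[ℂ] (BondIdx D → Matrix (Fin N) (Fin N) ℂ)}
      {HV : (BondIdx D → Matrix (Fin N) (Fin N) ℂ) →ₗ[ℂ] (PBond (F.P K) 0 → Matrix (Fin N) (Fin N) ℂ)}
      (_ : ∀ (A : PBond (F.P K) 0 → Matrix (Fin N) (Fin N) ℂ) (b : PBond (F.P K) 0),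
        DV A b = ∑ j, ((WithLp.ofLp (deltaAE D ((F.P K).L ^ (K - n) : ℝ) (fun _ => (1 : ℝ)) (WithLp.toLp 2 (Pi.single j 1))) b : ℝ) : ℂ) • A j)
      (_ : ∀ (A : PBond (F.P K) 0 → Matrix (Fin N) (Fin N) ℂ) (b : PBond (F.P K) 0),
        GV A b = ∑ j, ((WithLp.ofLp ((GE D (c := ((F.P K).L : ℝ) ^ (K - n)) (pow_ne_zero _ (Nat.cast_ne_zero.2 (F.P K).L_pos.ne')) (w := fun _ => (1 : ℝ)) (fun _ => one_pos)
          - hOp (GE D (c := ((F.P K).L : ℝ) ^ (K - n)) (pow_ne_zero _ (Nat.cast_ne_zero.2 (F.P K).L_pos.ne')) (w := fun _ => (1 : ℝ)) (fun _ => one_pos)) (QsE D)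
              (EE D (c := ((F.P K).L : ℝ) ^ (K - n)) (pow_ne_zero _ (Nat.cast_ne_zero.2 (F.P K).L_pos.ne')) (w := fun _ => (1 : ℝ)) (fun _ => one_pos))
            ∘ₗ QE D ∘ₗ GE D (c := ((F.P K).L : ℝ) ^ (K - n)) (pow_ne_zero _ (Nat.cast_ne_zero.2 (F.P K).L_pos.ne')) (w := fun _ => (1 : ℝ)) (fun _ => one_pos))
          (WithLp.toLp 2 (Pi.single j 1))) b : ℝ) : ℂ) • A j)
      (_ : ∀ (A : PBond (F.P K) 0 → Matrix (Fin N) (Fin N) ℂ) (t : BondIdx D),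
        QV A t = ∑ j, ((WithLp.ofLp (QE D (WithLp.toLp 2 (Pi.single j 1))) t : ℝ) : ℂ) • A j)
      (_ : ∀ (B : BondIdx D → Matrix (Fin N) (Fin N) ℂ) (b : PBond (F.P K) 0),
        HV B b = ∑ t, ((WithLp.ofLp (hOp (GE D (c := ((F.P K).L : ℝ) ^ (K - n)) (pow_ne_zero _ (Nat.cast_ne_zero.2 (F.P K).L_pos.ne')) (w := fun _ => (1 : ℝ)) (fun _ => one_pos))
          (QsE D) (EE D (c := ((F.P K).L : ℝ) ^ (K - n)) (pow_ne_zero _ (Nat.cast_ne_zero.2 (F.P K).L_pos.ne')) (w := fun _ => (1 : ℝ)) (fun _ => one_pos))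
          (WithLp.toLp 2 (Pi.single t 1))) b : ℝ) : ℂ) • B t)
      (W : (PBond (F.P K) 0 → Matrix (Fin N) (Fin N) ℂ) → (PBond (F.P K) 0 → Matrix (Fin N) (Fin N) ℂ)) {C₄ a₃ ρ : ℝ}
      (_ : ∀ (Y : PBond (F.P K) 0 → Matrix (Fin N) (Fin N) ℂ) (r : ℝ), r < a₃ → (∀ b, w 1 b * ‖Y b‖ ≤ r) →
        (∀ (b : PBond (F.P K) 0) (ν : Fin 4), w 2 b * (F.L : ℝ) ^ (K - n) * ‖Y ⟨b.src.shift ν, b.dir⟩ - Y b‖ ≤ r) →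
          ∀ b, w 3 b * ‖W Y b‖ ≤ C₄ * r ^ 2)
      (X : PBond (F.P K) 0 → lieSU (Fin N))
      (_ : ∀ j, (W (fun b => ((X b : lieSU (Fin N)) : Matrix (Fin N) (Fin N) ℂ)) j)ᴴ = -(W (fun b => ((X b : lieSU (Fin N)) : Matrix (Fin N) (Fin N) ℂ)) j))
      (_ : ∀ j, (W (fun b => ((X b : lieSU (Fin N)) : Matrix (Fin N) (Fin N) ℂ)) j).trace = 0)
      (_ : ∀ δ : PBond (F.P K) 0 → lieSU (Fin N), QV (fun j => ((δ j : lieSU (Fin N)) : Matrix (Fin N) (Fin N) ℂ)) = 0 →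
        ∑ j, (((δ j : lieSU (Fin N)) : Matrix (Fin N) (Fin N) ℂ)ᴴ *
          (DV (fun b => ((X b : lieSU (Fin N)) : Matrix (Fin N) (Fin N) ℂ)) j + W (fun b => ((X b : lieSU (Fin N)) : Matrix (Fin N) (Fin N) ℂ)) j)).trace.re = 0)
      (_ : ρ < a₃) (_ : ∀ b, w 1 b * ‖((X b : lieSU (Fin N)) : Matrix (Fin N) (Fin N) ℂ)‖ ≤ ρ)
      (_ : ∀ (b : PBond (F.P K) 0) (ν : Fin 4),
        w 2 b * (F.L : ℝ) ^ (K - n) * ‖((X ⟨b.src.shift ν, b.dir⟩ : lieSU (Fin N)) : Matrix (Fin N) (Fin N) ℂ) - ((X b : lieSU (Fin N)) : Matrix (Fin N) (Fin N) ℂ)‖ ≤ ρ),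
      (∀ b : PBond (F.P K) 0,
        w 1 b * ‖((fun b => ((X b : lieSU (Fin N)) : Matrix (Fin N) (Fin N) ℂ)) - HV (QV fun b => ((X b : lieSU (Fin N)) : Matrix (Fin N) (Fin N) ℂ))) b‖
          ≤ B₀ * (C₄ * ρ ^ 2)) ∧
      (∀ (b : PBond (F.P K) 0) (ν : Fin 4),
        w 2 b * (F.L : ℝ) ^ (K - n) *
          ‖((fun b => ((X b : lieSU (Fin N)) : Matrix (Fin N) (Fin N) ℂ)) - HV (QV fun b => ((X b : lieSU (Fin N)) : Matrix (Fin N) (Fin N) ℂ))) ⟨b.src.shift ν, b.dir⟩ -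
            ((fun b => ((X b : lieSU (Fin N)) : Matrix (Fin N) (Fin N) ℂ)) - HV (QV fun b => ((X b : lieSU (Fin N)) : Matrix (Fin N) (Fin N) ℂ))) b‖
          ≤ B₀ * (C₄ * ρ ^ 2)) ∧
      ∀ b : PBond (F.P K) 0,
        w 3 b * ((F.L : ℝ) ^ (K - n)) ^ 2 *
          ‖∑ ν : Fin 4, ((((fun b => ((X b : lieSU (Fin N)) : Matrix (Fin N) (Fin N) ℂ)) - HV (QV fun b => ((X b : lieSU (Fin N)) : Matrix (Fin N) (Fin N) ℂ))) b - ((fun b => ((X b : lieSU (Fin N)) : Matrix (Fin N) (Fin N) ℂ)) - HV (QV fun b => ((X b : lieSU (Fin N)) : Matrix (Fin N) (Fin N) ℂ))) ⟨b.src.shift ν, b.dir⟩) +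
            (((fun b => ((X b : lieSU (Fin N)) : Matrix (Fin N) (Fin N) ℂ)) - HV (QV fun b => ((X b : lieSU (Fin N)) : Matrix (Fin N) (Fin N) ℂ))) b - ((fun b => ((X b : lieSU (Fin N)) : Matrix (Fin N) (Fin N) ℂ)) - HV (QV fun b => ((X b : lieSU (Fin N)) : Matrix (Fin N) (Fin N) ℂ))) ⟨b.src.unshift ν, b.dir⟩))‖
          ≤ B₀ * (C₄ * ρ ^ 2) := by
  obtain ⟨Mh₀, R₀, B₀, δ₀, B₃, -, -, hmain⟩ := body_of_adm22_T4 F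
  refine ⟨Mh₀, R₀, B₀, ?_⟩
  intro n K hk1 hk' Mh R a' hMha hMh hR hsize D hDk hAdm w hw instDE instDB DV GV QV HV hDV hGV hQV hHV W C₄ a₃ ρ hWq X hWA hWtr h128 hρ h1 h2
  exact letter165_rows_of_critical128_bodyAt F K (K - n) D (levWeight_nonneg hw) (hmain n K hk1 hk' hMha hMh hR hsize D hDk hAdm w hw)
    hDV hGV hQV hHV W hWq X hWA hWtr h128 hρ h1 h2

end Entry165

end Summit.QuantumFields.YangMills.Theorems.K0Stub1Letter165GtLetterAtRecord

end
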